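import Summits.QuantumFields.BalabanUV.T4Continuum.Support.NE7EtaRatesD4Cov

/-!
# NE7EtaRatesD4CovReg — route #1 of the NE7 crux, hardest stub S1∕L7b-background: two loose ends of the covariant display —
# (a) the one-run facts «`W = rescale L (bavg L UB)` unitary and `N L^k`-periodic» DISCHARGED from `Regular` (the class data of the
# run-B minimiser) under the k-free small-field condition of the substrate; (b) the two covariant-gradient CONVENTIONS (start-point,
# as printed for `U = U′Ũ`; end-point, as the tree's `vary W Z 1 = W·e^Z`) differ by a conjugated plaquette variable, hence by
# at most `2·‖W(∂p) − 1‖·‖Z‖`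

Cell `pub-balaban`, rung (B)+1 sub-cell t4, lineage `b2b-balaban-t4-ne7-p1`, generation 22 (CRUX PROVER NE7 #1, ruling e34b3e0c); crux
skeleton `t4/skeletons/NE7-CRUX-R1.md` v1.6.1 §3ter; sequel of `NE7EtaRatesD4Cov` (p252735).  HONEST FRAMING (page 1): FIXED FINITE T⁴,
rung (B)+1; NE7, NE3 NOT PRINTED in [Balaban1984PropagatorsI]–[Balaban1989LargeFieldII] and NOT PROVED here; continuum YM on T⁴ ⇐ BetaPertH ∧
nine spine estimates (0/9 proved); BetaPertH ⇐ (D1) ∧ (D4) ∧ CAP+tail; G-an2-4 gates asym, D1 and NE2/3/4; NOT infinite volume, NOT mass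
gap, NOT Clay.

WHAT.
 * §1 `unitary_periodic_rescale_bavg_of_regular` — `Regular 4 L N b g (k+1) UB`, `0 ≤ b`, `512·5·8·L²·b ≤ 1`, `L ≥ 1` ⇒ `rescale L (bavg L UB)`
   is unitary (`MinimalActionLevels.isUnitaryCfg_rescale_bavg`, B7 Prop. 1's domain) and `N L^k`-periodic (`isPeriodicCfg_rescale_bavg`);
   `closeness_rates_cov_of_ne3EnergyRateW_reg` — `NE7EtaRatesD4Cov.closeness_rates_cov_of_ne3EnergyRateW` with those two displayed
   hypotheses replaced by the k-FREE condition on `b` (so the only NE3-side inputs left are T-E_w and the covariant Lipschitz antecedents).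
 * §2 `covDiff_start_sub_end` ∕ `norm_covDiff_start_sub_end_le` — with `A x κ := Ad (W x κ) (Z x κ)` (the START-point representative,
   `W·e^Z = e^{A}·W` bondwise) the start-point covariant difference `Ad (W x μ) (A (x + e μ) κ) − A x κ` equals
   `Ad (W x κ)` of the end-point one `Ad (W (x + e κ) μ) (Z (x + e μ) κ) − Z x κ` up to `Ad (W x μ W (x+e μ) κ) Z′ − Ad (W x κ W (x+e κ) μ) Z′`,
   whose norm is `≤ 2‖W(∂p) − 1‖·‖Z (x + e μ) κ‖` (`p` the plaquette at `x` in the plane `(μ, κ)`): on a small field of radius `a` the two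
   (1.13)-gradients agree up to `2a·sup‖Z‖` — below every rate of the display (`a ≍ ξ²`, `sup‖Z‖ ≍ θ^{8k}`), so NODE O may read either.
HONEST.  One-run class bookkeeping + an identity ([folklore]); nothing of NE3∕NE7 discharged; 0 def; 0 sorry.
-/

set_option autoImplicit false

open scoped BigOperators Matrix Matrix.Norms.L2Operator
open Finset

namespace Summit.QuantumFields.BalabanUV.T4Continuum.NE7EtaRatesD4CovReg

open Literature.MathematicalPhysics.QuantumFieldTheory.Balaban1983to89
open B7Prop1Explicit B7Prop2Explicit
open T4AveragingDeficitWall hiding Site Plane Plaq Bond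
open T4AveragingDeficitWallBoundary (periodBox IsPeriodicCfg)
open AveragingDeficitPeriodicCounting (IsPeriodicDir)
open T4AveragingDeficitNonAbelian (Ad_mul Ad_sub)
open AveragingDeficitTransport (norm_Ad_of_unitary)
open AveragingDeficitNearIdentity (norm_Ad_sub_le)
open MinimalActionSandwich (IsMinimiser)
open MinimalActionRate (Regular)
open MinimalActionLevels (isUnitaryCfg_rescale_bavg isPeriodicCfg_rescale_bavg)
open NE3EnergyShapes (IsUnitarySite IsPeriodicSite)
open NE3EnergyWeightedShapes (energyNormW NE3EnergyRateW)
open AveragingDeficitDualResidual (dualC1 dualC2)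
open AveragingDeficitDerivWallProof (wallConst)
open NE7EtaRatesD4Cov (closeness_rates_cov_of_ne3EnergyRateW)

noncomputable section

variable {n : Type*} [Fintype n] [DecidableEq n]

/-! ## §1 The one-run facts from `Regular` -/

/-- **THE ONCE-AVERAGED REGULAR MINIMISER IS UNITARY AND `N L^k`-PERIODIC** (`d = 4`): `Regular 4 L N b g (k+1) UB` (unitary,
`N L^{k+1}`-periodic, small field of radius `b∕(L^{k+1})²`), `0 ≤ b`, the substrate's k-FREE averaging condition `512·5·8·L²·b ≤ 1`, `L ≥ 1`.
[folklore] -/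
theorem unitary_periodic_rescale_bavg_of_regular [Nonempty n] {L N k : ℕ} (hL : 1 ≤ L) {b g : ℝ} (hb : 0 ≤ b)
    (hbs : 512 * (4 + 1) * (4 + 4) * (L : ℝ) ^ 2 * b ≤ 1) {UB : Site 4 → Fin 4 → (Matrix n n ℂ)ˣ}
    (hreg : Regular 4 L N b g (k + 1) UB) :
    IsUnitaryCfg (rescale L (bavg L UB)) ∧ IsPeriodicCfg (rescale L (bavg L UB)) ((N * L ^ k : ℕ) : ℤ) := by
  have hL1 : (1 : ℝ) ≤ (L : ℝ) := by exact_mod_cast hL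
  have hs1 : (1 : ℝ) ≤ ((L : ℝ) ^ (k + 1)) ^ 2 := one_le_pow₀ (one_le_pow₀ hL1)
  have haB0 : 0 ≤ b / ((L : ℝ) ^ (k + 1)) ^ 2 := div_nonneg hb (by positivity)
  have haBb : b / ((L : ℝ) ^ (k + 1)) ^ 2 ≤ b := div_le_self hb hs1
  have hsmall : 512 * ((4 : ℕ) + 1 : ℝ) * ((4 : ℕ) + 4) * (L : ℝ) ^ 2 * (b / ((L : ℝ) ^ (k + 1)) ^ 2) ≤ 1 := by
    have h0 : (0 : ℝ) ≤ 512 * ((4 : ℕ) + 1 : ℝ) * ((4 : ℕ) + 4) * (L : ℝ) ^ 2 := by positivity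
    have := mul_le_mul_of_nonneg_left haBb h0
    push_cast at this hbs ⊢
    linarith
  refine ⟨isUnitaryCfg_rescale_bavg L hL hreg.unitary haB0 hsmall hreg.small, ?_⟩
  have hper : IsPeriodicCfg UB ((L : ℤ) * ((N * L ^ k : ℕ) : ℤ)) := by
    have e1 : ((L : ℤ) * ((N * L ^ k : ℕ) : ℤ)) = ((N * L ^ (k + 1) : ℕ) : ℤ) := by push_cast; ring
    rw [e1]; exact hreg.periodic
  exact isPeriodicCfg_rescale_bavg L hper

/-- **THE COVARIANT DISPLAY WITH THE ONE-RUN FACTS DISCHARGED**: `NE7EtaRatesD4Cov.closeness_rates_cov_of_ne3EnergyRateW` with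
«`W` unitary, `N L^k`-periodic» replaced by `0 ≤ b`, `512·5·8·L²·b ≤ 1` (read off `Regular` of the run-B minimiser). [folklore] -/
theorem closeness_rates_cov_of_ne3EnergyRateW_reg [Nonempty n] {𝒞 : ℕ → Set (Site 4 → Fin 4 → (Matrix n n ℂ)ˣ)} {L N : ℕ}
    (hL : 2 ≤ L) (hN : 1 ≤ N) {θ : ℝ} (hθ : 0 < θ) (hθ6 : θ ^ 6 = ((L : ℝ))⁻¹) {b g C : ℝ} (hb : 0 ≤ b)
    (hbs : 512 * (4 + 1) * (4 + 4) * (L : ℝ) ^ 2 * b ≤ 1) (hg : 0 ≤ g) (hC : 0 ≤ C)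
    {dom : Set (Site 4 → Fin 4 → (Matrix n n ℂ)ˣ)} (h : NE3EnergyRateW 4 𝒞 L N b g C dom) {γ : ℝ} (hγ : 0 < γ)
    (hγ3 : C * (wallConst 4 L * (N : ℝ) ^ 2 * (Real.sqrt g * dualC2 4 L + 2 * b ^ 2 * dualC1 4 L)) ≤ γ ^ 3)
    {k : ℕ} (hk : 1 ≤ k) {V : Site 4 → Fin 4 → (Matrix n n ℂ)ˣ} (hV : V ∈ dom)
    {UA UB : Site 4 → Fin 4 → (Matrix n n ℂ)ˣ} (hA : IsMinimiser 4 𝒞 L N k V UA) (hB : IsMinimiser 4 𝒞 L N (k + 1) V UB)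
    (hreg : Regular 4 L N b g (k + 1) UB) :
    ∃ (u : Site 4 → (Matrix n n ℂ)ˣ) (Z : Site 4 → Fin 4 → Matrix n n ℂ),
      IsUnitarySite u ∧ IsPeriodicSite u ((N * L ^ k : ℕ) : ℤ) ∧ IsSkewDir Z ∧ IsPeriodicDir Z ((N * L ^ k : ℕ) : ℤ) ∧
      gaugeAct u UA = vary (rescale L (bavg L UB)) Z 1 ∧
      (∀ (Λ₁ l₁ Λ₂' : ℝ), 0 < l₁ → Λ₁ ≤ l₁ ^ 3 → 0 < Λ₂' →
        (∀ (κ : Fin 4) (x : Site 4) (μ : Fin 4),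
          ‖Ad (rescale L (bavg L UB) (x + e κ) μ) (Z (x + e μ) κ) - Z x κ‖ ≤ Λ₁ * (((L : ℝ)⁻¹) ^ k) ^ 2) →
        (∀ (κ μ : Fin 4) (y : Site 4),
          ‖Ad (rescale L (bavg L UB) (y + e κ) μ)
              (Ad (rescale L (bavg L UB) (y + e κ + e μ) μ) (Z (y + (2 : ℕ) • e μ) κ) - Z (y + e μ) κ)
            - (Ad (rescale L (bavg L UB) (y + e κ) μ) (Z (y + e μ) κ) - Z y κ)‖ ≤ Λ₂' * (((L : ℝ)⁻¹) ^ k) ^ 3) →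
        γ * (θ ^ k) ^ 2 ≤ l₁ * N →
          (∀ (x : Site 4) (κ : Fin 4), ‖Z x κ‖ ≤ 8 * l₁ ^ 2 * γ * θ ^ (8 * k)) ∧
          (∀ (x : Site 4) (μ κ : Fin 4),
            ‖Ad (rescale L (bavg L UB) (x + e κ) μ) (Z (x + e μ) κ) - Z x κ‖ ≤ 4 * l₁ * Real.sqrt (2 * γ * Λ₂') * θ ^ (13 * k))) ∧
      (∀ (μ ν : Fin 4) (hμν : μ < ν) (Λ₁ l₁ Λ₂ l₂ : ℝ), 0 < l₁ → Λ₁ ≤ l₁ ^ 3 → 0 < l₂ → Λ₂ ≤ l₂ ^ 3 →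
        (∀ (κ : Fin 4) (x : Site 4) (ρ : Fin 4),
          ‖Ad (rescale L (bavg L UB) (x + e κ) ρ) (Z (x + e ρ) κ) - Z x κ‖ ≤ Λ₁ * (((L : ℝ)⁻¹) ^ k) ^ 2) →
        (∀ (x : Site 4) (ρ : Fin 4),
          ‖Ad (rescale L (bavg L UB) x ρ) (curl (rescale L (bavg L UB)) Z (x + e ρ, ⟨(μ, ν), hμν⟩))
              - curl (rescale L (bavg L UB)) Z (x, ⟨(μ, ν), hμν⟩)‖ ≤ Λ₂ * (((L : ℝ)⁻¹) ^ k) ^ 3) →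
        γ * (θ ^ k) ^ 2 ≤ l₁ * N → γ * (θ ^ k) ^ 2 ≤ l₂ * N →
          (∀ x : Site 4, ‖curl (rescale L (bavg L UB)) Z (x, ⟨(μ, ν), hμν⟩)‖ ≤ 8 * l₂ ^ 2 * γ * θ ^ (14 * k)) ∧
          (∀ z : Site 4,
            ‖((hol (gaugeAct u UA) z (plaqWord μ ν) : (Matrix n n ℂ)ˣ) : Matrix n n ℂ)
                - ((hol (rescale L (bavg L UB)) z (plaqWord μ ν) : (Matrix n n ℂ)ˣ) : Matrix n n ℂ)‖
              ≤ (8 * l₂ ^ 2 * γ + 1536 * l₁ ^ 4 * γ ^ 2 * Real.exp (8 * l₁ ^ 2 * γ)) * θ ^ (14 * k))) := by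
  obtain ⟨hWu, hWP⟩ := unitary_periodic_rescale_bavg_of_regular (by omega : 1 ≤ L) hb hbs hreg
  exact closeness_rates_cov_of_ne3EnergyRateW hL hN hθ hθ6 hg hC h hγ hγ3 hk hV hA hB hreg hWu hWP

/-! ## §2 The two covariant-gradient conventions differ by a conjugated plaquette variable -/

/-- **START-POINT vs END-POINT COVARIANT DIFFERENCE — THE IDENTITY.**  With `A x κ := Ad (W x κ) (Z x κ)`:
`(Ad (W x μ) (A (x + e μ) κ) − A x κ) − Ad (W x κ) (Ad (W (x + e κ) μ) (Z (x + e μ) κ) − Z x κ)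
   = Ad (W x μ · W (x + e μ) κ) Z′ − Ad (W x κ · W (x + e κ) μ) Z′`, `Z′ = Z (x + e μ) κ` (the two transports around the plaquette). [folklore] -/
theorem covDiff_start_sub_end (W : Site 4 → Fin 4 → (Matrix n n ℂ)ˣ) (Z : Site 4 → Fin 4 → Matrix n n ℂ) (x : Site 4)
    (κ μ : Fin 4) :
    (Ad (W x μ) (Ad (W (x + e μ) κ) (Z (x + e μ) κ)) - Ad (W x κ) (Z x κ))
        - Ad (W x κ) (Ad (W (x + e κ) μ) (Z (x + e μ) κ) - Z x κ)
      = Ad (W x μ * W (x + e μ) κ) (Z (x + e μ) κ) - Ad (W x κ * W (x + e κ) μ) (Z (x + e μ) κ) := by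
  rw [Ad_sub, Ad_mul, Ad_mul]
  abel

/-- **… AND THE BOUND** (`W` unitary): the norm of that difference is `≤ 2·‖W(∂p) − 1‖·‖Z (x + e μ) κ‖`, `p` the plaquette at `x` in the
plane `(μ, κ)` — so on a small field of radius `a` the start-point (printed, `U = U′Ũ`) and end-point (tree, `W·e^Z`) covariant gradients
of the discrepancy agree up to `2a·sup‖Z‖`. [folklore] -/
theorem norm_covDiff_start_sub_end_le [Nonempty n] {W : Site 4 → Fin 4 → (Matrix n n ℂ)ˣ} (hW : IsUnitaryCfg W)
    (Z : Site 4 → Fin 4 → Matrix n n ℂ) (x : Site 4) (κ μ : Fin 4) :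
    ‖(Ad (W x μ) (Ad (W (x + e μ) κ) (Z (x + e μ) κ)) - Ad (W x κ) (Z x κ))
        - Ad (W x κ) (Ad (W (x + e κ) μ) (Z (x + e μ) κ) - Z x κ)‖
      ≤ 2 * ‖((hol W x (plaqWord μ κ) : (Matrix n n ℂ)ˣ) : Matrix n n ℂ) - 1‖ * ‖Z (x + e μ) κ‖ := by
  rw [covDiff_start_sub_end]
  set a : (Matrix n n ℂ)ˣ := W x μ * W (x + e μ) κ with ha
  set b : (Matrix n n ℂ)ˣ := W x κ * W (x + e κ) μ with hb
  set X := Z (x + e μ) κ with hX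
  have hbu : b ∈ unitaryUnits (Matrix n n ℂ) := (unitaryUnits _).mul_mem (hW _ _) (hW _ _)
  have hbiu : b⁻¹ ∈ unitaryUnits (Matrix n n ℂ) := (unitaryUnits _).inv_mem hbu
  have hau : a ∈ unitaryUnits (Matrix n n ℂ) := (unitaryUnits _).mul_mem (hW _ _) (hW _ _)
  -- Ad a X − Ad b X = Ad b (Ad (b⁻¹ a) X − X)
  have h1 : Ad a X - Ad b X = Ad b (Ad (b⁻¹ * a) X - X) := by
    rw [Ad_sub, ← Ad_mul, mul_inv_cancel_left]
  -- the plaquette variable: hol = a b⁻¹, so b⁻¹ a = b⁻¹ hol b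
  have hhol : hol W x (plaqWord μ κ) = a * b⁻¹ := by
    apply Units.ext
    rw [val_hol_plaqWord, ha, hb]
    simp only [Units.val_mul, mul_inv_rev, Units.val_mul, mul_assoc]
  have h2 : b⁻¹ * a = b⁻¹ * hol W x (plaqWord μ κ) * b := by
    rw [hhol]; group
  have h3 : ‖(((b⁻¹ * a : (Matrix n n ℂ)ˣ)) : Matrix n n ℂ) - 1‖ = ‖((hol W x (plaqWord μ κ) : (Matrix n n ℂ)ˣ) : Matrix n n ℂ) - 1‖ := by
    have e1 : (((b⁻¹ * a : (Matrix n n ℂ)ˣ)) : Matrix n n ℂ) - 1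
        = Ad b⁻¹ (((hol W x (plaqWord μ κ) : (Matrix n n ℂ)ˣ) : Matrix n n ℂ) - 1) := by
      rw [h2]
      unfold Ad
      simp only [Units.val_mul, inv_inv, mul_sub, sub_mul, mul_one]
      rw [Units.inv_mul]
    rw [e1, norm_Ad_of_unitary hbiu]
  calc ‖Ad a X - Ad b X‖ = ‖Ad b (Ad (b⁻¹ * a) X - X)‖ := by rw [h1]
    _ = ‖Ad (b⁻¹ * a) X - X‖ := norm_Ad_of_unitary hbu _
    _ ≤ 2 * ‖(((b⁻¹ * a : (Matrix n n ℂ)ˣ)) : Matrix n n ℂ) - 1‖ * ‖X‖ :=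
        norm_Ad_sub_le ((unitaryUnits _).mul_mem hbiu hau) X
    _ = 2 * ‖((hol W x (plaqWord μ κ) : (Matrix n n ℂ)ˣ) : Matrix n n ℂ) - 1‖ * ‖X‖ := by rw [h3]

end

end Summit.QuantumFields.BalabanUV.T4Continuum.NE7EtaRatesD4CovReg
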